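import Literature.Geometry.Riemannian.RicciDeTurckMaxPoint
import Literature.Geometry.Riemannian.RicciDeTurckReduction
import HarnessLib

/-!
# Uniqueness of the Ricci–DeTurck flow on a closed manifold
(topic `Geometry/Riemannian`)

Twelfth and last layer of the DeTurck decomposition of the named fact
`Literature.Geometry.Riemannian.ricciFlow_uniqueness` (`RicciFlow.lean`; Hamilton 1982,
Thm. 5.1; Topping 2006, Thm. 5.2.2). It PROVES hypothesis (RU) of the reduction theorem
`ricciFlow_uniqueness_of_deTurck` (`RicciDeTurckReduction.lean`): **two Ricci–DeTurck
flows on a closed manifold, relative to the same Levi-Civita background and with the same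
Riemannian initial metric, coincide** (`ricciDeTurckFlow_uniqueness`; Andrews–Hopper 2011,
§5.4.2, Step 1: "by the standard theory of strictly parabolic equations the Ricci–DeTurck flow
has a unique solution"; Topping 2006, §5.2). The proof is the maximum principle applied to
`u = |k₁ - k₂|²_h` in the maximum-point form `le_zero_of_deriv_le_mul_at_isMaxOn`
(`MaximumPrincipleAtMaxima.lean`; Topping 2006, Thm. 3.1.1): `u` is continuous on
`M × [0, δ]`, differentiable in time, vanishes at `t = 0`, and at a positive spatial maximum
`∂ₜu ≤ C u` by the chart estimate `exists_maxPoint_const` (`RicciDeTurckMaxPoint.lean`) and a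
finite atlas of the compact manifold; hence `u ≤ 0`, `u = 0`, `k₁ = k₂`.

Consequently the named fact `ricciFlow_uniqueness` (Hamilton 1982, Thm. 5.1) is reduced to the
single remaining hypothesis (GE), short-time existence of the DeTurck gauge (harmonic map heat
flow into `(M, ḡ(0))`, Eells–Sampson), see `ricciFlow_uniqueness_of_gauge`. Everything in this
file is proved; no named fact and no `sorry` is introduced.

## Contents (all proved)

* `normSq_sub_eq_chartNormSq_extChartAt`, `continuousOn_normSq_sub` — `u` read in charts and its
  continuity on `M × S`.
* **`ricciDeTurckFlow_uniqueness`** — hypothesis (RU), with exactly the binders of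
  `ricciFlow_uniqueness_of_deTurck`.
* **`ricciFlow_uniqueness_of_gauge`** — the fact `ricciFlow_uniqueness` from (GE) alone.

## References

* B. Andrews, C. Hopper, *The Ricci flow in Riemannian geometry*, LNM 2011 (2011), §5.4.2,
  Step 1 and Step 6. [AndrewsHopper2011]
* P. Topping, *Lectures on the Ricci flow*, LMS LNS 325 (2006), Thm. 3.1.1, §5.2, Thm. 5.2.2.
  [Topping2006]
* R. S. Hamilton, Three-manifolds with positive Ricci curvature, J. Differential Geom. 17
  (1982), Thm. 5.1. [Hamilton1982]
* D. M. DeTurck, Deforming metrics in the direction of their Ricci tensors, J. Differential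
  Geom. 18 (1983). [DeTurck1983]
-/

noncomputable section

set_option maxSynthPendingDepth 3

open Bundle Set Function Filter FiberBundle VectorField ContinuousLinearMap TopologicalSpace Metric
open scoped Manifold ContDiff Topology

universe u v w

namespace Literature.Geometry.Riemannian

open Lorentzian Lorentzian.OpensChart Lorentzian.PseudoRiemannianMetric Literature.Geometry.Manifold
open Literature.Geometry.Riemannian.OpensChart

/-! ### `u = |k₁ - k₂|²_h` read in charts -/

section Assembly

variable {E : Type*} [NormedAddCommGroup E] [NormedSpace ℝ E] {H : Type*} [TopologicalSpace H]
  {I : ModelWithCorners ℝ E H} [I.Boundaryless] {M : Type*} [TopologicalSpace M]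
  [ChartedSpace H M] [IsManifold I ∞ M] [FiniteDimensional ℝ E]
  {ι : Type*} [Fintype ι] [DecidableEq ι]

/-- `|k₁(t) - k₂(t)|²_h (x) = û_t(extChartAt I z x)` for `x` in the chart domain of `z`
(`normSq_sub_eq_chartNormSq` at the point `extChartAt I z x` of the chart target).
[cite: ONeill1983, Ch. 3, Prop. 3.59] -/
theorem normSq_sub_eq_chartNormSq_extChartAt (b : Module.Basis ι ℝ E)
    (h : PseudoRiemannianMetric I ∞ E (TangentSpace I : M → Type _))
    (k₁ k₂ : ℝ → PseudoRiemannianMetric I ∞ E (TangentSpace I : M → Type _)) (z : M) (t : ℝ)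
    {x : M} (hx : x ∈ (chartAt H z).source) :
    h.normSq x ((k₁ t).toBilinForm x - (k₂ t).toBilinForm x) =
      chartNormSq I b h k₁ k₂ z t (extChartAt I z x) := by
  have h1 := normSq_sub_eq_chartNormSq b h k₁ k₂ z t
    ⟨extChartAt I z x, (extChartAt I z).map_source (by rwa [_root_.extChartAt_source])⟩
  rw [chartInv_extChartAt z hx] at h1
  exact h1

/-- **`(x, t) ↦ |k₁(t) - k₂(t)|²_h (x)` is continuous on `M × S`** for families `C^∞` on
`M × S` (read in the chart at each point: `continuousOn_chartNormSq`). [folklore] -/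
theorem continuousOn_normSq_sub
    {k₁ k₂ : ℝ → PseudoRiemannianMetric I ∞ E (TangentSpace I : M → Type _)} {S : Set ℝ}
    (hk₁ : IsContMDiffFamilyOn ∞ k₁ S) (hk₂ : IsContMDiffFamilyOn ∞ k₂ S)
    (h : PseudoRiemannianMetric I ∞ E (TangentSpace I : M → Type _)) :
    ContinuousOn (fun p : M × ℝ ↦
      h.normSq p.1 ((k₁ p.2).toBilinForm p.1 - (k₂ p.2).toBilinForm p.1)) (univ ×ˢ S) := by
  classical
  intro p hp
  set b := Module.finBasis ℝ E
  have hz : p.1 ∈ (chartAt H p.1).source := mem_chart_source H p.1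
  have hN : (chartAt H p.1).source ×ˢ (univ : Set ℝ) ∈ 𝓝 p :=
    ((chartAt H p.1).open_source.prod isOpen_univ).mem_nhds ⟨hz, mem_univ _⟩
  -- the representative composed with the chart is continuous within `source × S`
  have hmap : MapsTo (fun p' : M × ℝ ↦ (extChartAt I p.1 p'.1, p'.2))
      ((chartAt H p.1).source ×ˢ S) ((extChartAt I p.1).target ×ˢ S) := by
    intro p' hp'
    refine ⟨(extChartAt I p.1).map_source ?_, hp'.2⟩
    rw [_root_.extChartAt_source]
    exact hp'.1
  have hg : ContinuousWithinAt (fun p' : M × ℝ ↦ (extChartAt I p.1 p'.1, p'.2))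
      ((chartAt H p.1).source ×ˢ S) p :=
    (((continuousAt_extChartAt p.1).comp continuousAt_fst).prodMk continuousAt_snd).continuousWithinAt
  have hcomp : ContinuousWithinAt
      (fun p' : M × ℝ ↦ chartNormSq I b h k₁ k₂ p.1 p'.2 (extChartAt I p.1 p'.1))
      ((chartAt H p.1).source ×ˢ S) p :=
    ContinuousWithinAt.comp (f := fun p' : M × ℝ ↦ (extChartAt I p.1 p'.1, p'.2)) (x := p)
      (continuousOn_chartNormSq b hk₁ hk₂ h p.1 _ (hmap ⟨hz, hp.2⟩)) hg hmap
  -- `source × S` is a neighbourhood of `p` within `univ × S`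
  have hmem : (chartAt H p.1).source ×ˢ S ∈ 𝓝[univ ×ˢ S] p :=
    mem_of_superset (inter_mem_nhdsWithin (univ ×ˢ S) hN) fun q hq ↦ ⟨hq.2.1, hq.1.2⟩
  -- the two functions agree near `p`
  have heq : (fun p' : M × ℝ ↦ h.normSq p'.1 ((k₁ p'.2).toBilinForm p'.1 - (k₂ p'.2).toBilinForm p'.1))
      =ᶠ[𝓝[univ ×ˢ S] p]
      fun p' : M × ℝ ↦ chartNormSq I b h k₁ k₂ p.1 p'.2 (extChartAt I p.1 p'.1) := by
    filter_upwards [mem_nhdsWithin_of_mem_nhds hN] with p' hp'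
    exact normSq_sub_eq_chartNormSq_extChartAt b h k₁ k₂ p.1 p'.2 hp'.1
  exact (hcomp.mono_of_mem_nhdsWithin hmem).congr_of_eventuallyEq heq
    (normSq_sub_eq_chartNormSq_extChartAt b h k₁ k₂ p.1 p.2 hz)

end Assembly

/-! ### Uniqueness of the Ricci–DeTurck flow -/

/-- **Uniqueness of the Ricci–DeTurck flow on a closed manifold** — hypothesis (RU) of
`ricciFlow_uniqueness_of_deTurck` (`RicciDeTurckReduction.lean`), with exactly its
binders. Let `M` be a compact `C^∞` manifold without boundary, `h` a Riemannian metric with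
Levi-Civita connection `bg`, and `(k₁, c₁)`, `(k₂, c₂)` two Ricci–DeTurck flows on `[0, δ]`
relative to the background `bg` (`IsRicciDeTurckFlow`: families `C^∞` on `M × [0, δ]`
satisfying `∂ₜk = -2 Ric(k) + ℒ_{W(k, bg)} k`), Riemannian, with `k₁ 0 = k₂ 0`. Then `k₁ = k₂`
on `[0, δ]`. Andrews–Hopper 2011, §5.4.2, Step 1 ("by the standard theory of strictly
parabolic equations"); Topping 2006, §5.2. PROOF (that standard theory, carried out): with
`u(t, x) = |k₁(t) - k₂(t)|²_h (x)`, continuous on `M × [0, δ]` (`continuousOn_normSq_sub`),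
differentiable in `t` with derivative `2⟨∂ₜ(k₁ - k₂), k₁ - k₂⟩_h` computed in charts from the
coordinate Ricci–DeTurck equations (`hasDerivWithinAt_chartNormSq`), `u(0, ·) = 0`, and
`∂ₜu ≤ C u` at every positive spatial maximum (`exists_maxPoint_const` on the closed balls of a
finite atlas, `C` the maximum of the chart constants): the maximum principle
`le_zero_of_deriv_le_mul_at_isMaxOn` (Topping 2006, Thm. 3.1.1) gives `u ≤ 0`, so `u = 0` and
`k₁ = k₂` (`normSq_eq_zero_iff`). [cite: AndrewsHopper2011, §5.4.2, Step 1]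
[cite: Topping2006, §5.2 and Thm. 3.1.1] -/
theorem ricciDeTurckFlow_uniqueness {E : Type u} [NormedAddCommGroup E] [NormedSpace ℝ E]
    [FiniteDimensional ℝ E] [CompleteSpace E] {H : Type v} [TopologicalSpace H]
    (I : ModelWithCorners ℝ E H) [I.Boundaryless] (M : Type w) [TopologicalSpace M] [T2Space M]
    [SecondCountableTopology M] [CompactSpace M] [ChartedSpace H M] [IsManifold I ∞ M]
    (h : PseudoRiemannianMetric I ∞ E (TangentSpace I : M → Type _))
    (bg : CovariantDerivative I E (TangentSpace I : M → Type _))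
    (hh : h.IsRiemannian) (hbg : h.IsLeviCivita bg) (δ : ℝ) (hδ : 0 < δ)
    (k₁ k₂ : ℝ → PseudoRiemannianMetric I ∞ E (TangentSpace I : M → Type _))
    (c₁ c₂ : ℝ → CovariantDerivative I E (TangentSpace I : M → Type _))
    (hk₁ : IsRicciDeTurckFlow k₁ c₁ bg (Icc 0 δ)) (hk₂ : IsRicciDeTurckFlow k₂ c₂ bg (Icc 0 δ))
    (hR₁ : ∀ t ∈ Icc 0 δ, (k₁ t).IsRiemannian) (_hR₂ : ∀ t ∈ Icc 0 δ, (k₂ t).IsRiemannian)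
    (h0 : k₁ 0 = k₂ 0) : ∀ t ∈ Icc 0 δ, k₁ t = k₂ t := by
  classical
  set b := Module.finBasis ℝ E with hb
  set u : ℝ → M → ℝ := fun t x ↦ h.normSq x ((k₁ t).toBilinForm x - (k₂ t).toBilinForm x) with hu
  have hUD : UniqueDiffOn ℝ (Icc 0 δ) := uniqueDiffOn_Icc hδ
  -- `u` read in the chart at `z`
  have hux : ∀ (z : M) (t : ℝ) {x : M}, x ∈ (chartAt H z).source →
      u t x = chartNormSq I b h k₁ k₂ z t (extChartAt I z x) := fun z t x hx ↦
    normSq_sub_eq_chartNormSq_extChartAt b h k₁ k₂ z t hx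
  -- (i) continuity on `M × [0, δ]`
  have hcont : ContinuousOn (fun p : M × ℝ ↦ u p.2 p.1) (univ ×ˢ Icc 0 δ) :=
    continuousOn_normSq_sub hk₁.smooth hk₂.smooth h
  -- (ii) the time derivative, computed in the chart at `z`
  have hderz : ∀ (z : M) {t : ℝ}, t ∈ Icc 0 δ → ∀ {x : M}, x ∈ (chartAt H z).source →
      HasDerivWithinAt (fun s ↦ u s x)
        (2 * normSqCoord b (gramInv b (chartRep I (fun _ ↦ h) z 0 (extChartAt I z x)))
          (chartDot I b h k₁ k₂ z t (extChartAt I z x))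
          (chartRep I k₁ z t (extChartAt I z x) - chartRep I k₂ z t (extChartAt I z x)))
        (Icc 0 δ) t := by
    intro z t ht x hx
    have h1 := hasDerivWithinAt_chartNormSq b hk₁ hk₂ hbg z ht
      ⟨extChartAt I z x, (extChartAt I z).map_source (by rwa [_root_.extChartAt_source])⟩
    have hfun : (fun s ↦ u s x) = fun s ↦ chartNormSq I b h k₁ k₂ z s (extChartAt I z x) :=
      funext fun s ↦ hux z s hx
    rw [hfun]
    exact h1
  have hderiv : ∀ t ∈ Icc 0 δ, ∀ x, HasDerivWithinAt (fun s ↦ u s x)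
      (derivWithin (fun s ↦ u s x) (Icc 0 δ) t) (Icc 0 δ) t := fun t ht x ↦
    (hderz x ht (mem_chart_source H x)).differentiableWithinAt.hasDerivWithinAt
  -- (iii) `∂ₜu ≤ C u` at positive spatial maxima, `C` from a finite atlas
  obtain ⟨C, hC⟩ : ∃ C : ℝ, ∀ t ∈ Ioc 0 δ, ∀ x, IsMaxOn (u t) univ x → 0 < u t x →
      derivWithin (fun s ↦ u s x) (Icc 0 δ) t ≤ C * u t x := by
    -- a closed coordinate ball around every point
    have hr : ∀ z : M, ∃ r > 0, closedBall (extChartAt I z z) r ⊆ (extChartAt I z).target :=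
      fun z ↦ Metric.nhds_basis_closedBall.mem_iff.1
        ((isOpen_extChartAt_target z).mem_nhds (mem_extChartAt_target z))
    choose r hr hrt using hr
    -- the chart constants
    have hCz : ∀ z : M, ∃ Cz : ℝ, ∀ t ∈ Icc 0 δ, ∀ y₀ ∈ closedBall (extChartAt I z z) (r z),
        IsLocalMax (chartNormSq I b h k₁ k₂ z t) y₀ →
        2 * normSqCoord b (gramInv b (chartRep I (fun _ ↦ h) z 0 y₀)) (chartDot I b h k₁ k₂ z t y₀)
            (chartRep I k₁ z t y₀ - chartRep I k₂ z t y₀) ≤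
          Cz * chartNormSq I b h k₁ k₂ z t y₀ := fun z ↦
      exists_maxPoint_const b hδ hk₁.smooth hk₂.smooth hR₁ hh z (isCompact_closedBall _ _) (hrt z)
    choose Cz hCz using hCz
    -- a finite subcover by the open coordinate balls
    set V : M → Set M := fun z ↦
      (extChartAt I z).source ∩ extChartAt I z ⁻¹' ball (extChartAt I z z) (r z) with hV
    have hVo : ∀ z, IsOpen (V z) := fun z ↦
      (continuousOn_extChartAt z).isOpen_inter_preimage (isOpen_extChartAt_source z) isOpen_ball
    have hVz : ∀ z, z ∈ V z := fun z ↦ ⟨mem_extChartAt_source z, mem_ball_self (hr z)⟩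
    obtain ⟨s, hs⟩ := isCompact_univ.elim_finite_subcover V hVo
      (fun x _ ↦ mem_iUnion.2 ⟨x, hVz x⟩)
    refine ⟨∑ z ∈ s, |Cz z|, fun t ht x hmax hpos ↦ ?_⟩
    obtain ⟨z, hzs, hxV⟩ := mem_iUnion₂.1 (hs (mem_univ x))
    have hxs : x ∈ (chartAt H z).source := by
      rw [← _root_.extChartAt_source (I := I)]
      exact hxV.1
    have ht' : t ∈ Icc 0 δ := Ioc_subset_Icc_self ht
    have hy₀K : extChartAt I z x ∈ closedBall (extChartAt I z z) (r z) :=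
      ball_subset_closedBall hxV.2
    have hy₀t : extChartAt I z x ∈ (extChartAt I z).target := hrt z hy₀K
    -- `extChartAt I z x` is a local maximum of `û_t`
    have hlmax : IsLocalMax (chartNormSq I b h k₁ k₂ z t) (extChartAt I z x) := by
      refine Filter.eventually_of_mem ((isOpen_extChartAt_target z).mem_nhds hy₀t) fun y hy ↦ ?_
      have h1 := normSq_sub_eq_chartNormSq b h k₁ k₂ z t ⟨y, hy⟩
      have h2 : u t (chartInv I z ⟨y, hy⟩) ≤ u t x := isMaxOn_iff.1 hmax _ (mem_univ _)
      rw [hux z t hxs] at h2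
      simp only [hu] at h2
      rw [h1] at h2
      exact h2
    -- the derivative and the estimate
    have hd := hderz z ht' hxs
    rw [hd.derivWithin (hUD t ht')]
    have hest := hCz z t ht' _ hy₀K hlmax
    have hueq : u t x = chartNormSq I b h k₁ k₂ z t (extChartAt I z x) := hux z t hxs
    have hCle : Cz z ≤ ∑ z ∈ s, |Cz z| :=
      (le_abs_self _).trans (Finset.single_le_sum (f := fun z ↦ |Cz z|)
        (fun z _ ↦ abs_nonneg (Cz z)) hzs)
    calc 2 * normSqCoord b (gramInv b (chartRep I (fun _ ↦ h) z 0 (extChartAt I z x)))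
          (chartDot I b h k₁ k₂ z t (extChartAt I z x))
          (chartRep I k₁ z t (extChartAt I z x) - chartRep I k₂ z t (extChartAt I z x))
        ≤ Cz z * chartNormSq I b h k₁ k₂ z t (extChartAt I z x) := hest
      _ = Cz z * u t x := by rw [hueq]
      _ ≤ (∑ z ∈ s, |Cz z|) * u t x := mul_le_mul_of_nonneg_right hCle hpos.le
  -- (iv) the maximum principle
  have hu0 : ∀ x, u 0 x ≤ 0 := fun x ↦ by
    simp only [hu, h0, sub_self, PseudoRiemannianMetric.normSq_zero, le_refl]
  have hle := le_zero_of_deriv_le_mul_at_isMaxOn hcont hderiv C hC hu0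
  -- conclusion: `u = 0`, hence `k₁ = k₂`
  intro t ht
  refine pseudoRiemannianMetric_eq_of_val_apply_eq fun x X Y ↦ ?_
  have h1 : u t x = 0 := le_antisymm (hle t ht x) (h.normSq_nonneg x hh _)
  have h2 : (k₁ t).toBilinForm x - (k₂ t).toBilinForm x = 0 :=
    (h.normSq_eq_zero_iff x hh _).1 h1
  have h3 := LinearMap.congr_fun₂ (sub_eq_zero.1 h2) X Y
  simpa only [PseudoRiemannianMetric.toBilinForm_apply] using h3

/-! ### What remains for `ricciFlow_uniqueness`: the DeTurck gauge -/

/-- **`ricciFlow_uniqueness` (Hamilton 1982, Thm. 5.1; Topping 2006, Thm. 5.2.2) from the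
existence of the DeTurck gauge alone.** With (RU) proved (`ricciDeTurckFlow_uniqueness`), the
reduction `ricciFlow_uniqueness_of_deTurck` (`RicciDeTurckReduction.lean`) leaves exactly one
hypothesis: (GE), short-time existence, on closed manifolds, of the solution `φ_t` of the
harmonic map heat flow `∂ₜφ = Δ_{ḡ(t), ḡ(0)} φ`, `φ₀ = id`, for a Ricci flow `ḡ`, packaged as a
Ricci–DeTurck flow `g` with `ḡ(t) = φ_t^* g(t)` and `φ_t` the flow of `-W` (Andrews–Hopper 2011,
§5.4.2, Step 6, via Thm. 4.13 (Eells–Sampson); Topping 2006, §5.2, p. 45; Chow–Knopf 2004,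
§3.4). [cite: Hamilton1982, Thm. 5.1] [cite: AndrewsHopper2011, §5.4.2, proof of Thm. 5.2, Step 6]
[cite: Topping2006, §5.2, p. 45 and Thm. 5.2.2] -/
theorem ricciFlow_uniqueness_of_gauge
    (hGE : ∀ {E : Type u} [NormedAddCommGroup E] [NormedSpace ℝ E] [FiniteDimensional ℝ E]
      [CompleteSpace E] {H : Type v} [TopologicalSpace H] (I : ModelWithCorners ℝ E H)
      [I.Boundaryless] (M : Type w) [TopologicalSpace M] [T2Space M] [SecondCountableTopology M]
      [CompactSpace M] [ChartedSpace H M] [IsManifold I ∞ M] (T : ℝ), 0 < T →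
      ∀ (gbar : ℝ → PseudoRiemannianMetric I ∞ E (TangentSpace I : M → Type _))
        (covbar : ℝ → CovariantDerivative I E (TangentSpace I : M → Type _))
        (bg : CovariantDerivative I E (TangentSpace I : M → Type _)),
        IsRicciFlow gbar covbar (Icc 0 T) → (∀ t ∈ Icc 0 T, (gbar t).IsRiemannian) →
        (gbar 0).IsLeviCivita bg →
        ∃ δ : ℝ, 0 < δ ∧ δ ≤ T ∧
          ∃ (φ : ℝ → M → M) (g : ℝ → PseudoRiemannianMetric I ∞ E (TangentSpace I : M → Type _))
            (cov : ℝ → CovariantDerivative I E (TangentSpace I : M → Type _)),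
            IsRicciDeTurckFlow g cov bg (Icc 0 δ) ∧ (∀ t ∈ Icc 0 δ, (g t).IsRiemannian) ∧
            g 0 = gbar 0 ∧ φ 0 = id ∧
            (∀ t ∈ Icc 0 δ, (gbar t).val = pullbackBilin (I := I) (I' := I) (φ t) (g t).val) ∧
            (∀ p : M, IsTimeDepMIntegralCurveOn (fun t ↦ φ t p)
              (fun t x ↦ -deTurckField (g t) (cov t) bg x) (Icc 0 δ)) ∧
            ContMDiffOn (I.prod 𝓘(ℝ, ℝ)) I.tangent 1
              (fun q : M × ℝ ↦ (⟨q.1, -deTurckField (g q.2) (cov q.2) bg q.1⟩ : TangentBundle I M))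
              (univ ×ˢ Icc 0 δ)) :
    ricciFlow_uniqueness.{u, v, w} :=
  ricciFlow_uniqueness_of_deTurck ricciDeTurckFlow_uniqueness hGE

end Literature.Geometry.Riemannian

end
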